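import Summits.CriticalPhenomena.PercolationContinuityZ3.Theorems.SoloInformedCubeLemma
import Summits.CriticalPhenomena.PercolationContinuityZ3.Theorems.SoloInformedSlabBoxFace
import HarnessLib

/-!
# The mirror-cutset step of the Bollobás–Riordan lemma transfers to sheets
(solo seat `solo-CriticalPhenomena-informed`, paper §7b.3 (d6) "what transfers", step (i))

In the Bollobás–Riordan proof of the Russo–Seymour–Welsh lemma (B. Bollobás, O. Riordan, *A short
proof of the Harris–Kesten theorem*, Bull. LMS 38 (2006), arXiv:math/0410359, Lemma 6; *Percolation*,
CUP 2006, ch. 3) the left-most open top–bottom crossing `P₁` of a square and its mirror image `P₁'` in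
a side of the square form a (not necessarily open) path crossing the doubled square, which every
transversal open crossing must meet.  This file certifies the codimension-one analogue in `ℤ^d`:

Let `σ` be the reflection `x_k ↦ 2c − x_k` (`mirrorK k c`), `S ⊆ {x_k ≤ c}` a site set (a box with a
face on the mirror plane), `F ⊆ S` (a face).  In a configuration `ω` let `W = wet S F ω` be the set
of sites joined to `F` by open paths inside `S`; its edge boundary inside `S` consists of closed
edges (`Σ`, the "lowest closed sheet" when `F` is the bottom face).

* `mirror_exit` — deterministic core: an edge `{z, z'}` of `ℤ^d` inside the doubled set `S ∪ σS`
  that exits `W ∪ σW` is either an edge of `S` leaving `W`, or the mirror image of one.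
* `exists_mirror_dart` — hence every OPEN lattice path inside `S ∪ σS` from `F ∪ σF` to `T ∪ σT`,
  `T ⊆ S` not joined to `F` inside `S`, has a step `{z, z'}` whose mirror image `{σz, σz'}` is an
  edge of `S` from `W` to `S ∖ W` — in particular a CLOSED edge (`not_adj_of_mem_wet`): the union
  of the closed sheet `Σ` and its (not necessarily closed) mirror image `σΣ` separates the doubled
  face from its opposite in the doubled box, exactly as `P₁ ∪ P₁'` does for paths.

What does not transfer is recorded in the paper: the first meeting of a path with `P₁ ∪ P₁'` is a
point (on `P₁` or on `P₁'`, each with probability `≥ 1/2` of the total by symmetry), whereas the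
seam of a transversal closed cutset with `Σ ∪ σΣ` is a curve, generically crossing the mirror plane.

References: Bollobás–Riordan, arXiv:math/0410359, Lemma 6 p. 6; *Percolation* (CUP 2006) p. 53.
[folklore]
-/

noncomputable section

namespace Summit.CriticalPhenomena.PercolationContinuityZ3.Theorems

open MeasureTheory ProbabilityTheory Filter Topology
open Literature.Probability.Percolation Literature.Probability.LatticeModels
open Literature.Probability.Percolation.CerfDembinVanishing
open scoped ENNReal

namespace SurfaceTension

variable {d : ℕ}

/-! ## The reflection in the hyperplane `x_k = c` -/

/-- The reflection `x_k ↦ 2c − x_k` of `ℤ^d` in the INTEGER hyperplane `x_k = c` (it fixes the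
sites of that hyperplane; the library's `SAW.Zd.reflK` reflects in the half-integer hyperplane
`x_k = M + 1/2` and fixes no site). -/
def mirrorK (k : Fin d) (c : ℤ) (x : Site d) : Site d := Function.update x k (2 * c - x k)

/-- The reflected coordinate. -/
@[simp] theorem mirrorK_apply_same (k : Fin d) (c : ℤ) (x : Site d) :
    mirrorK k c x k = 2 * c - x k := by
  simp [mirrorK]

/-- The other coordinates are unchanged. -/
theorem mirrorK_apply_of_ne (k : Fin d) (c : ℤ) (x : Site d) {j : Fin d} (hj : j ≠ k) :
    mirrorK k c x j = x j := by
  simp [mirrorK, Function.update_of_ne hj]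

/-- `mirrorK` is an involution. -/
@[simp] theorem mirrorK_mirrorK (k : Fin d) (c : ℤ) (x : Site d) : mirrorK k c (mirrorK k c x) = x := by
  ext j
  by_cases hj : j = k
  · subst hj; simp [mirrorK]
  · rw [mirrorK_apply_of_ne k c _ hj, mirrorK_apply_of_ne k c _ hj]

/-- A site on the mirror plane is fixed. -/
theorem mirrorK_eq_self {k : Fin d} {c : ℤ} {x : Site d} (hx : x k = c) : mirrorK k c x = x := by
  ext j
  by_cases hj : j = k
  · subst hj; rw [mirrorK_apply_same, hx]; ring
  · exact mirrorK_apply_of_ne k c x hj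

/-- A site of the half-space `{x_k ≤ c}` whose mirror image is also in it lies on the mirror plane. -/
theorem eq_of_le_of_mirrorK_le {k : Fin d} {c : ℤ} {x : Site d} (hx : x k ≤ c)
    (hσx : mirrorK k c x k ≤ c) : x k = c := by
  rw [mirrorK_apply_same] at hσx
  omega

/-! ## The deterministic core -/

/-- **Mirror exit.** `S ⊆ {x_k ≤ c}`, `W ⊆ S`, `σ = mirrorK k c`.  If `{z, z'}` is an edge of `ℤ^d`
with `z'` in the doubled set `S ∪ σS`, `z ∈ W ∪ σW` and `z' ∉ W ∪ σW`, then either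
`{z, z'}` is an edge of `S` leaving `W` (`z ∈ W`, `z' ∈ S ∖ W`) or its mirror image is
(`σz ∈ W`, `σz' ∈ S ∖ W`). -/
theorem mirror_exit {k : Fin d} {c : ℤ} {S W : Set (Site d)} (hS : ∀ x ∈ S, x k ≤ c)
    (hW : W ⊆ S) {z z' : Site d} (hadj : (zdGraph d).Adj z z')
    (hz'D : z' ∈ S ∨ mirrorK k c z' ∈ S)
    (hz : z ∈ W ∨ mirrorK k c z ∈ W) (hz' : ¬ (z' ∈ W ∨ mirrorK k c z' ∈ W)) :
    (z ∈ W ∧ z' ∈ S ∧ z' ∉ W) ∨ (mirrorK k c z ∈ W ∧ mirrorK k c z' ∈ S ∧ mirrorK k c z' ∉ W) := by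
  push Not at hz'
  have hstep := coord_sub_le_one_of_adj hadj k
  rcases hz with hzW | hσzW
  · -- `z ∈ W ⊆ S`
    by_cases hz'S : z' ∈ S
    · exact Or.inl ⟨hzW, hz'S, hz'.1⟩
    · have hσz'S : mirrorK k c z' ∈ S := hz'D.resolve_left hz'S
      -- `z'` is strictly beyond the mirror plane, `z` on it
      have h1 : z k ≤ c := hS z (hW hzW)
      have h2 : c ≤ z' k := by
        have := hS _ hσz'S; rw [mirrorK_apply_same] at this; omega
      have h3 : z' k ≠ c := fun h => hz'S (by rw [← mirrorK_eq_self h]; exact hσz'S)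
      have hzk : z k = c := by omega
      refine Or.inr ⟨by rw [mirrorK_eq_self hzk]; exact hzW, hσz'S, hz'.2⟩
  · -- `σz ∈ W ⊆ S`
    by_cases hσz'S : mirrorK k c z' ∈ S
    · exact Or.inr ⟨hσzW, hσz'S, hz'.2⟩
    · have hz'S : z' ∈ S := hz'D.resolve_right hσz'S
      have h1 : c ≤ z k := by
        have := hS _ (hW hσzW); rw [mirrorK_apply_same] at this; omega
      have h2 : z' k ≤ c := hS z' hz'S
      have h3 : z' k ≠ c := fun h => hσz'S (by rw [mirrorK_eq_self h]; exact hz'S)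
      have hzk : z k = c := by omega
      refine Or.inl ⟨?_, hz'S, hz'.1⟩
      have := hσzW; rwa [mirrorK_eq_self hzk] at this

/-! ## The wet region of a face and the mirror cutset -/

/-- The wet region of `F` inside `S`: sites joined to a site of `F` by an open path inside `S`. -/
def wet (S F : Set (Site d)) (ω : BondConfig (Site d)) : Set (Site d) :=
  {x | ∃ f ∈ F, ω ∈ inConn S f x}

/-- `F ⊆ wet S F ω`. -/
theorem subset_wet (S F : Set (Site d)) (ω : BondConfig (Site d)) : F ⊆ wet S F ω :=
  fun f hf => ⟨f, hf, mem_inConn_iff.2 SimpleGraph.Reachable.rfl⟩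

/-- `wet S F ω ⊆ S` when `F ⊆ S`. -/
theorem wet_subset {S F : Set (Site d)} (hF : F ⊆ S) (ω : BondConfig (Site d)) :
    wet S F ω ⊆ S := by
  rintro x ⟨f, hf, hfx⟩
  obtain ⟨P⟩ := mem_inConn_iff.1 hfx
  have := getVert_mem_of_le_withinGraph (G := zdGraph d)
    (H := openGraph ω ⊓ withinGraph (zdGraph d) S) inf_le_right P (hF hf) P.length
  simpa using this

/-- The wet region is closed under open edges of `S`: an open edge from `wet S F ω` into `S` stays
in it. -/
theorem mem_wet_of_adj {S F : Set (Site d)} {ω : BondConfig (Site d)} (hF : F ⊆ S) {z z' : Site d}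
    (hz : z ∈ wet S F ω) (hz' : z' ∈ S) (hadj : (openGraph ω).Adj z z')
    (hG : (zdGraph d).Adj z z') : z' ∈ wet S F ω := by
  obtain ⟨f, hf, hfz⟩ := hz
  refine ⟨f, hf, mem_inConn_iff.2 ((mem_inConn_iff.1 hfz).trans (SimpleGraph.Adj.reachable ?_))⟩
  rw [SimpleGraph.inf_adj, withinGraph_adj]
  exact ⟨hadj, hG, wet_subset hF ω ⟨f, hf, hfz⟩, hz'⟩

/-- An edge of `S` leaving the wet region is closed. -/
theorem not_adj_of_mem_wet {S F : Set (Site d)} {ω : BondConfig (Site d)} (hF : F ⊆ S)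
    {z z' : Site d} (hz : z ∈ wet S F ω) (hz' : z' ∈ S) (hz'W : z' ∉ wet S F ω)
    (hG : (zdGraph d).Adj z z') : ¬ (openGraph ω).Adj z z' :=
  fun h => hz'W (mem_wet_of_adj hF hz hz' h hG)

/-- If `F` is not joined to `T ⊆ S` inside `S`, neither `T` nor `σT` meets `W ∪ σW`. -/
theorem not_mem_wet_of_mem {k : Fin d} {c : ℤ} {S F T : Set (Site d)} (hS : ∀ x ∈ S, x k ≤ c)
    (hF : F ⊆ S) (hT : T ⊆ S) {ω : BondConfig (Site d)} (hω : ω ∉ linked S F T) {v : Site d}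
    (hv : v ∈ T ∨ mirrorK k c v ∈ T) : ¬ (v ∈ wet S F ω ∨ mirrorK k c v ∈ wet S F ω) := by
  have key : ∀ t ∈ T, t ∉ wet S F ω := by
    rintro t ht ⟨f, hf, hft⟩
    exact hω (mem_linked_iff.2 ⟨f, hf, t, ht, hft⟩)
  -- a site of `S` whose mirror image is in `S` is fixed by the reflection
  have fix : ∀ x, x ∈ S → mirrorK k c x ∈ S → mirrorK k c x = x := fun x hx hσx =>
    mirrorK_eq_self (eq_of_le_of_mirrorK_le (hS x hx) (hS _ hσx))
  rintro (hvW | hσvW)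
  · rcases hv with hvT | hσvT
    · exact key v hvT hvW
    · have h := fix v (wet_subset hF ω hvW) (hT hσvT)
      rw [h] at hσvT; exact key v hσvT hvW
  · rcases hv with hvT | hσvT
    · have h := fix v (hT hvT) (wet_subset hF ω hσvW)
      rw [h] at hσvW; exact key v hvT hσvW
    · exact key _ hσvT hσvW

/-- **Mirror cutset (Bollobás–Riordan step (i) for sheets).** `S ⊆ {x_k ≤ c}`, `F, T ⊆ S`,
`σ = mirrorK k c`, and `ω` a configuration in which `F` is not joined to `T` inside `S`.  Then every
open lattice path with all its sites in the doubled set `S ∪ σS`, from a site of `F ∪ σF` to a site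
of `T ∪ σT`, has a step `(z, z')` whose mirror image `(σz, σz')` is an edge of `S` from the wet
region `W` of `F` to `S ∖ W` — a closed edge of the lowest separating sheet.  (`σΣ` itself need
not be closed; the statement is about the union `Σ ∪ σΣ` as a set of edges.) -/
theorem exists_mirror_dart {k : Fin d} {c : ℤ} {S F T : Set (Site d)} (hS : ∀ x ∈ S, x k ≤ c)
    (hF : F ⊆ S) (hT : T ⊆ S) {ω : BondConfig (Site d)} (hω : ω ∉ linked S F T) {u v : Site d}
    (hu : u ∈ F ∨ mirrorK k c u ∈ F) (hv : v ∈ T ∨ mirrorK k c v ∈ T)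
    (P : (openGraph ω ⊓ zdGraph d).Walk u v)
    (hP : ∀ x ∈ P.support, x ∈ S ∨ mirrorK k c x ∈ S) :
    ∃ dt ∈ P.darts, mirrorK k c dt.fst ∈ wet S F ω ∧ mirrorK k c dt.snd ∈ S ∧
      mirrorK k c dt.snd ∉ wet S F ω ∧
      ¬ (openGraph ω).Adj (mirrorK k c dt.fst) (mirrorK k c dt.snd) := by
  set W := wet S F ω with hWdef
  have hWS : W ⊆ S := wet_subset hF ω
  have huU : u ∈ {x | x ∈ W ∨ mirrorK k c x ∈ W} := by
    rcases hu with h | h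
    · exact Or.inl (subset_wet S F ω h)
    · exact Or.inr (subset_wet S F ω h)
  have hvU : v ∉ {x | x ∈ W ∨ mirrorK k c x ∈ W} := not_mem_wet_of_mem hS hF hT hω hv
  obtain ⟨dt, hdt, hfst, hsnd⟩ := P.exists_boundary_dart _ huU hvU
  have hadj : (openGraph ω ⊓ zdGraph d).Adj dt.fst dt.snd := dt.adj
  rw [SimpleGraph.inf_adj] at hadj
  have hsndD := hP _ (P.dart_snd_mem_support_of_mem_darts hdt)
  rcases mirror_exit hS hWS hadj.2 hsndD hfst hsnd with ⟨h1, h2, h3⟩ | ⟨h1, h2, h3⟩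
  · -- an open edge of `S` cannot leave the wet region
    exact absurd hadj.1 (not_adj_of_mem_wet hF h1 h2 h3 hadj.2)
  · refine ⟨dt, hdt, h1, h2, h3, not_adj_of_mem_wet hF h1 h2 h3 ?_⟩
    -- the mirror image of a lattice edge is a lattice edge
    have hG := hadj.2
    rw [zdGraph_adj_iff] at hG ⊢
    obtain ⟨i, hi | hi⟩ := hG
    · by_cases hik : i = k
      · subst hik
        refine ⟨i, Or.inr ?_⟩
        ext j
        by_cases hj : j = i
        · subst hj; simp [mirrorK, hi]; omega
        · simp [mirrorK, Function.update_of_ne hj, hi, Pi.single_eq_of_ne hj]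
      · refine ⟨i, Or.inl ?_⟩
        ext j
        by_cases hj : j = k
        · subst hj; simp [mirrorK, hi, Pi.single_eq_of_ne (Ne.symm hik)]
        · simp [mirrorK, Function.update_of_ne hj, hi]
    · by_cases hik : i = k
      · subst hik
        refine ⟨i, Or.inl ?_⟩
        ext j
        by_cases hj : j = i
        · subst hj; simp [mirrorK, hi]; omega
        · simp [mirrorK, Function.update_of_ne hj, hi, Pi.single_eq_of_ne hj]
      · refine ⟨i, Or.inr ?_⟩
        ext j
        by_cases hj : j = k
        · subst hj; simp [mirrorK, hi, Pi.single_eq_of_ne (Ne.symm hik)]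
        · simp [mirrorK, Function.update_of_ne hj, hi]

end SurfaceTension

end Summit.CriticalPhenomena.PercolationContinuityZ3.Theorems
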